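import Mathlib.MeasureTheory.Function.ContinuousMapDense
import Mathlib.MeasureTheory.Function.L2Space
import Mathlib.Analysis.InnerProductSpace.Projection.Basic
import Mathlib.Topology.ContinuousMap.StoneWeierstrass
import Summits.Ventures.YMGap.Thresholds.LatticeBakryEmeryGroundState
import HarnessLib

/-!
# Venture YMGap — multi-link Bakry–Émery calculus, Part G1:
# the Hilbert space `L²(SU(N)^E, σ^{⊗E})`, the Haar-symmetric Laplacian, polynomial subspaces and
# their density

HONEST FRAMING: venture file (cell `pub-ymgap`, track (a), seat p2); Hilbert-space plumbing towards
a kernel proof of the multi-link Bakry–Émery Poincaré inequality on `SU(N)^E`, copied from the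
one-link tree file `SUNBakryEmeryPoincare.lean` Part G (first half) with `SU(N)` replaced by
`SU(N)^E`: continuous functions as elements of `L²`, `∫ F ΔG = -∫ Γ(F,G)`, the finite-dimensional
subspaces `V_n = 𝒫_n|_{SU(N)^E}` and their density (Stone–Weierstrass: the real coordinates of all
links separate the points of `SU(N)^E`).

## References

* Tree file `SUNBakryEmeryPoincare.lean`, Part G.
-/

noncomputable section

open scoped Matrix ComplexConjugate BigOperators Matrix.Norms.Frobenius ContDiff Topology InnerProductSpace
open Matrix Complex Finset MeasureTheory Filter
open Literature.MathematicalPhysics.QuantumFieldTheory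
open Literature.MathematicalPhysics.QuantumFieldTheory.SUNBakryEmery
  (FrameIdx frame SUN CoordIdx coordFn coordFn_true coordFn_false)

namespace Summit.Ventures.YMGap

namespace LatticeBakryEmery

universe u

variable {ι : Type u} [Fintype ι] [DecidableEq ι] {N : ℕ}

/-! ### Continuous functions as elements of `L²(σ^{⊗E})` -/

/-- The restriction of a continuous ambient function to `SU(N)^E` as a bundled continuous map. -/
def resCM (F : Cfg ι N → ℝ) (hF : Continuous fun g : PSU ι N => F (emb g)) : C(PSU ι N, ℝ) :=
  ⟨fun g => F (emb g), hF⟩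

omit [Fintype ι] [DecidableEq ι] in
/-- Evaluation of `resCM`. -/
@[simp] theorem resCM_apply (F : Cfg ι N → ℝ) (hF : Continuous fun g : PSU ι N => F (emb g)) (g : PSU ι N) :
    resCM F hF g = F (emb g) := rfl

variable (ι N) in
/-- The embedding `C(SU(N)^E, ℝ) → L²(σ^{⊗E})`. -/
abbrev toL2 : C(PSU ι N, ℝ) →L[ℝ] Lp ℝ 2 (haarPi ι N) := ContinuousMap.toLp 2 (haarPi ι N) ℝ

omit [DecidableEq ι] in
/-- Inner products of continuous functions in `L²` are integrals. -/
theorem inner_toL2_toL2 (φ ψ : C(PSU ι N, ℝ)) :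
    ⟪toL2 ι N φ, toL2 ι N ψ⟫_ℝ = ∫ g, φ g * ψ g ∂(haarPi ι N) := by
  rw [MeasureTheory.L2.inner_def]
  refine integral_congr_ae ?_
  filter_upwards [ContinuousMap.coeFn_toLp (p := 2) (μ := haarPi ι N) (𝕜 := ℝ) φ,
    ContinuousMap.coeFn_toLp (p := 2) (μ := haarPi ι N) (𝕜 := ℝ) ψ] with g hφ hψ
  rw [hφ, hψ, Real.inner_apply]

omit [DecidableEq ι] in
/-- Inner product of a continuous function with an arbitrary element of `L²`. -/
theorem inner_toL2_left (φ : C(PSU ι N, ℝ)) (x : Lp ℝ 2 (haarPi ι N)) :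
    ⟪toL2 ι N φ, x⟫_ℝ = ∫ g, φ g * x g ∂(haarPi ι N) := by
  rw [MeasureTheory.L2.inner_def]
  refine integral_congr_ae ?_
  filter_upwards [ContinuousMap.coeFn_toLp (p := 2) (μ := haarPi ι N) (𝕜 := ℝ) φ] with g hφ
  rw [hφ, Real.inner_apply]

omit [DecidableEq ι] in
/-- The norm in `L²` squared is the integral of the square. -/
theorem norm_sq_eq_integral (x : Lp ℝ 2 (haarPi ι N)) : ‖x‖ ^ 2 = ∫ g, x g ^ 2 ∂(haarPi ι N) := by
  rw [← real_inner_self_eq_norm_sq, MeasureTheory.L2.inner_def]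
  refine integral_congr_ae (ae_of_all _ fun g => ?_)
  simp only [Real.inner_apply, sq]

omit [DecidableEq ι] in
/-- `‖toL2 φ - x‖² = ∫ (φ - x)²`. -/
theorem norm_toL2_sub_sq (φ : C(PSU ι N, ℝ)) (x : Lp ℝ 2 (haarPi ι N)) :
    ‖toL2 ι N φ - x‖ ^ 2 = ∫ g, (φ g - x g) ^ 2 ∂(haarPi ι N) := by
  rw [norm_sq_eq_integral]
  refine integral_congr_ae ?_
  filter_upwards [Lp.coeFn_sub (toL2 ι N φ) x, ContinuousMap.coeFn_toLp (p := 2) (μ := haarPi ι N) (𝕜 := ℝ) φ]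
    with g hsub hφ
  rw [hsub, Pi.sub_apply, hφ]

omit [DecidableEq ι] in
/-- Elements of `L²` are integrable (probability space). -/
theorem integrable_L2 (x : Lp ℝ 2 (haarPi ι N)) : Integrable (fun g => x g) (haarPi ι N) :=
  (Lp.memLp x).integrable one_le_two

omit [DecidableEq ι] in
/-- Elements of `L²` are square integrable. -/
theorem integrable_sq_L2 (x : Lp ℝ 2 (haarPi ι N)) : Integrable (fun g => x g ^ 2) (haarPi ι N) := by
  have := (Lp.memLp x).integrable_sq
  exact this

omit [DecidableEq ι] in
/-- Products of a continuous function with an element of `L²` are integrable. -/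
theorem integrable_continuous_mul_L2 {φ : PSU ι N → ℝ} (hφ : Continuous φ) (x : Lp ℝ 2 (haarPi ι N)) :
    Integrable (fun g => φ g * x g) (haarPi ι N) := by
  obtain ⟨C, hC⟩ := (isCompact_univ (X := PSU ι N)).exists_bound_of_continuousOn hφ.continuousOn
  exact (integrable_L2 x).bdd_mul hφ.aestronglyMeasurable (ae_of_all _ fun g => hC g (Set.mem_univ _))

omit [DecidableEq ι] in
/-- `‖toL2 φ - toL2 ψ‖² = ∫ (φ - ψ)²`. -/
theorem norm_toL2_sub_toL2_sq (φ ψ : C(PSU ι N, ℝ)) :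
    ‖toL2 ι N φ - toL2 ι N ψ‖ ^ 2 = ∫ g, (φ g - ψ g) ^ 2 ∂(haarPi ι N) := by
  rw [norm_toL2_sub_sq]
  refine integral_congr_ae ?_
  filter_upwards [ContinuousMap.coeFn_toLp (p := 2) (μ := haarPi ι N) (𝕜 := ℝ) ψ] with g hψ
  rw [hψ]

omit [DecidableEq ι] in
/-- `‖toL2 φ‖² = ∫ φ²`. -/
theorem norm_toL2_sq (φ : C(PSU ι N, ℝ)) : ‖toL2 ι N φ‖ ^ 2 = ∫ g, φ g ^ 2 ∂(haarPi ι N) := by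
  rw [← real_inner_self_eq_norm_sq, inner_toL2_toL2]
  exact integral_congr_ae (ae_of_all _ fun g => by ring)

omit [DecidableEq ι] in
/-- **Cauchy–Schwarz against `L²`**: `|∫ φ x| ≤ (∫ φ²)^{1/2} ‖x‖`. -/
theorem abs_integral_mul_L2_le (φ : C(PSU ι N, ℝ)) (x : Lp ℝ 2 (haarPi ι N)) :
    |∫ g, φ g * x g ∂(haarPi ι N)| ≤ Real.sqrt (∫ g, φ g ^ 2 ∂(haarPi ι N)) * ‖x‖ := by
  rw [← inner_toL2_left, ← norm_toL2_sq, Real.sqrt_sq (norm_nonneg _)]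
  exact abs_real_inner_le_norm _ _

/-! ### The Haar-symmetric form of the Laplacian -/

section HaarSymm

/-- `Γ(c, G) = 0` for a constant `c`. -/
theorem Gam_const_left (c : ℝ) (G : Cfg ι N → ℝ) : Gam (fun _ => c) G = 0 := by
  funext Q
  simp [Gam, algD_const]

/-- `Δ c = 0` for a constant. -/
theorem Lap_const (c : ℝ) : Lap (fun _ : Cfg ι N => c) = 0 := by
  funext Q
  simp only [Lap, Pi.zero_apply]
  refine sum_eq_zero fun a _ => ?_
  rw [algD_const c]
  have : algD (bframe a) (0 : Cfg ι N → ℝ) = 0 := algD_const 0 _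
  rw [this, Pi.zero_apply]

/-- `Δ (F + G) = ΔF + ΔG`. -/
theorem Lap_add {F G : Cfg ι N → ℝ} (hF : ContDiff ℝ ∞ F) (hG : ContDiff ℝ ∞ G) :
    Lap (F + G) = Lap F + Lap G := by
  funext Q
  simp only [Lap, Pi.add_apply, ← sum_add_distrib]
  refine sum_congr rfl fun a _ => ?_
  rw [algD_add hF hG, algD_add (contDiff_algD hF _) (contDiff_algD hG _), Pi.add_apply]

/-- `Δ (r F) = r ΔF`. -/
theorem Lap_smul (r : ℝ) {F : Cfg ι N → ℝ} (hF : ContDiff ℝ ∞ F) : Lap (r • F) = r • Lap F := by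
  funext Q
  simp only [Lap, Pi.smul_apply, smul_eq_mul, mul_sum]
  refine sum_congr rfl fun a _ => ?_
  have h1 : algD (bframe a) (r • F) = fun Q => r * algD (bframe a) F Q := by
    show algD (bframe a) (fun Q => r * F Q) = _
    exact algD_const_mul hF r _
  rw [h1, algD_const_mul (contDiff_algD hF _)]

/-- `L_c G = Δ G` for a constant potential. -/
theorem genL_const (c : ℝ) (G : Cfg ι N → ℝ) : genL (fun _ => c) G = Lap G := by
  funext Q
  rw [genL, Gam_const_left]
  simp

end HaarSymm

/-- **`∫ F ΔG dσ^{⊗E} = -∫ Γ(F,G) dσ^{⊗E}`**. -/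
theorem integral_mul_Lap (hN : N ≠ 0) {F G : Cfg ι N → ℝ} (hF : ContDiff ℝ ∞ F) (hG : ContDiff ℝ ∞ G) :
    ∫ g : PSU ι N, F (emb g) * Lap G (emb g) ∂(haarPi ι N) = -∫ g : PSU ι N, Gam F G (emb g) ∂(haarPi ι N) := by
  have h := integral_mul_exp_mul_genL hN (S := fun _ => (0 : ℝ)) contDiff_const hF hG
  simp only [Real.exp_zero, one_mul, genL_const] at h
  exact h

/-- `∫ ΔG dσ^{⊗E} = 0`. -/
theorem integral_Lap (hN : N ≠ 0) {G : Cfg ι N → ℝ} (hG : ContDiff ℝ ∞ G) :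
    ∫ g : PSU ι N, Lap G (emb g) ∂(haarPi ι N) = 0 := by
  have h := integral_mul_Lap hN (F := fun _ => (1 : ℝ)) contDiff_const hG
  simp only [one_mul, Gam_const_left, Pi.zero_apply, integral_zero, neg_zero] at h
  exact h

/-! ### The subspaces `V_n = 𝒫_n|_{SU(N)^E} ⊂ L²(σ^{⊗E})` and their density -/

/-- Restriction `𝒫_n → C(SU(N)^E, ℝ)`. -/
def resPoly (n : ℕ) : polySpace ι N n →ₗ[ℝ] C(PSU ι N, ℝ) where
  toFun p := resCM p.1 (continuous_restrict (contDiff_of_mem_polySpace p.2))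
  map_add' p q := by ext g; rfl
  map_smul' c p := by ext g; rfl

omit [DecidableEq ι] in
/-- Evaluation of `resPoly`. -/
@[simp] theorem resPoly_apply {n : ℕ} (p : polySpace ι N n) (g : PSU ι N) : resPoly n p g = p.1 (emb g) := rfl

/-- `𝒫_n → L²(σ^{⊗E})`. -/
def TPoly (n : ℕ) : polySpace ι N n →ₗ[ℝ] Lp ℝ 2 (haarPi ι N) := (toL2 ι N).toLinearMap.comp (resPoly n)

omit [DecidableEq ι] in
/-- `TPoly n p = toL2 (resPoly n p)`. -/
theorem TPoly_apply {n : ℕ} (p : polySpace ι N n) : TPoly n p = toL2 ι N (resPoly n p) := rfl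

variable (ι N) in
/-- **`V_n`**: the image of `𝒫_n` in `L²(σ^{⊗E})`, a finite-dimensional subspace. -/
def VPoly (n : ℕ) : Submodule ℝ (Lp ℝ 2 (haarPi ι N)) := LinearMap.range (TPoly (ι := ι) (N := N) n)

/-- `V_n` is finite-dimensional. -/
instance VPoly.finiteDimensional (n : ℕ) : FiniteDimensional ℝ (VPoly ι N n) :=
  LinearMap.finiteDimensional_range _

/-- `V_n` is complete. -/
instance VPoly.completeSpace (n : ℕ) : CompleteSpace (VPoly ι N n) := FiniteDimensional.complete ℝ _

omit [DecidableEq ι] in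
/-- `V` is monotone. -/
theorem monotone_VPoly : Monotone (VPoly ι N) := by
  intro n n' h x hx
  obtain ⟨p, rfl⟩ := hx
  exact ⟨⟨p.1, polySpace_mono h p.2⟩, rfl⟩

/-- The coordinate functions as continuous maps on `SU(N)^E`. -/
def coordCM (κ : PCoordIdx ι N) : C(PSU ι N, ℝ) := resCM (pcoordFn κ) (continuous_restrict (contDiff_pcoordFn κ))

variable (ι N) in
/-- The polynomial subalgebra of `C(SU(N)^E, ℝ)`. -/
def polyAlg : Subalgebra ℝ C(PSU ι N, ℝ) := Algebra.adjoin ℝ (Set.range (coordCM (ι := ι) (N := N)))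

omit [DecidableEq ι] in
/-- The polynomial subalgebra separates points: two distinct link configurations differ in some real
coordinate of some link. -/
theorem polyAlg_separatesPoints : (polyAlg ι N).SeparatesPoints := by
  intro g h hgh
  obtain ⟨e, he⟩ : ∃ e, g e ≠ h e := by
    by_contra hc
    push Not at hc
    exact hgh (funext hc)
  have hne : (g e : Matrix (Fin N) (Fin N) ℂ) ≠ (h e : Matrix (Fin N) (Fin N) ℂ) := fun e' => he (Subtype.ext e')
  obtain ⟨a, b, hab⟩ : ∃ a b, (g e : Matrix (Fin N) (Fin N) ℂ) a b ≠ (h e : Matrix (Fin N) (Fin N) ℂ) a b := by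
    by_contra hc
    push Not at hc
    exact hne (Matrix.ext fun a b => hc a b)
  by_cases hre : ((g e : Matrix (Fin N) (Fin N) ℂ) a b).re = ((h e : Matrix (Fin N) (Fin N) ℂ) a b).re
  · have him : ((g e : Matrix (Fin N) (Fin N) ℂ) a b).im ≠ ((h e : Matrix (Fin N) (Fin N) ℂ) a b).im :=
      fun e' => hab (Complex.ext hre e')
    refine ⟨coordCM (e, (a, b, false)),
      ⟨coordCM (e, (a, b, false)), Algebra.subset_adjoin ⟨(e, (a, b, false)), rfl⟩, rfl⟩, ?_⟩
    simpa [coordCM, resCM, pcoordFn_apply, coordFn_false] using him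
  · refine ⟨coordCM (e, (a, b, true)),
      ⟨coordCM (e, (a, b, true)), Algebra.subset_adjoin ⟨(e, (a, b, true)), rfl⟩, rfl⟩, ?_⟩
    simpa [coordCM, resCM, pcoordFn_apply, coordFn_true] using hre

omit [DecidableEq ι] in
/-- Every polynomial on `SU(N)^E` is the restriction of an element of some `𝒫_n`. -/
theorem exists_resPoly_eq_of_mem_polyAlg {f : C(PSU ι N, ℝ)} (hf : f ∈ polyAlg ι N) :
    ∃ (n : ℕ) (p : polySpace ι N n), resPoly n p = f := by
  induction hf using Algebra.adjoin_induction with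
  | mem x hx =>
      obtain ⟨κ, rfl⟩ := hx
      exact ⟨1, ⟨pcoordFn κ, pcoordFn_mem_polySpace le_rfl κ⟩, rfl⟩
  | algebraMap r =>
      refine ⟨0, ⟨fun _ => r, const_mem_polySpace 0 r⟩, ?_⟩
      ext g
      simp [Algebra.algebraMap_eq_smul_one]
  | add x y _ _ hx hy =>
      obtain ⟨n, p, rfl⟩ := hx
      obtain ⟨n', q, rfl⟩ := hy
      refine ⟨max n n', ⟨p.1 + q.1, Submodule.add_mem _ (polySpace_mono (le_max_left _ _) p.2)
        (polySpace_mono (le_max_right _ _) q.2)⟩, ?_⟩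
      ext g; rfl
  | mul x y _ _ hx hy =>
      obtain ⟨n, p, rfl⟩ := hx
      obtain ⟨n', q, rfl⟩ := hy
      refine ⟨n + n', ⟨p.1 * q.1, mul_mem_polySpace p.2 q.2⟩, ?_⟩
      ext g; rfl

omit [DecidableEq ι] in
/-- **Density of the polynomial subspaces in `L²(σ^{⊗E})`** (Stone–Weierstrass on the compact group
`SU(N)^E` and density of continuous functions in `L²`). -/
theorem top_le_closure_iSup_VPoly : ⊤ ≤ (⨆ n, VPoly ι N n).topologicalClosure := by
  have hSW : (polyAlg ι N).topologicalClosure = ⊤ :=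
    ContinuousMap.subalgebra_topologicalClosure_eq_top_of_separatesPoints _ polyAlg_separatesPoints
  have hdenseA : Dense ((polyAlg ι N : Set C(PSU ι N, ℝ))) := by
    rw [dense_iff_closure_eq, ← Subalgebra.topologicalClosure_coe, hSW]
    rfl
  have hsub : (toL2 ι N) '' (polyAlg ι N : Set C(PSU ι N, ℝ)) ⊆ ↑(⨆ n, VPoly ι N n) := by
    rintro _ ⟨f, hf, rfl⟩
    obtain ⟨n, p, rfl⟩ := exists_resPoly_eq_of_mem_polyAlg hf
    exact (le_iSup (VPoly ι N) n) ⟨p, rfl⟩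
  have hdense : Dense ((toL2 ι N) '' (polyAlg ι N : Set C(PSU ι N, ℝ))) :=
    (ContinuousMap.toLp_denseRange ℝ (haarPi ι N) ℝ (p := 2) ENNReal.ofNat_ne_top).dense_image
      (toL2 ι N).continuous hdenseA
  rw [← Submodule.dense_iff_topologicalClosure_eq_top.1 (hdense.mono hsub)]

end LatticeBakryEmery

end Summit.Ventures.YMGap
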